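import Mathlib
import HarnessLib
import Summits.QuantumFields.YangMills.Theorems.MirrorModularBoostsHypercubicLimitCouplingResponseDefsC
import Summits.QuantumFields.YangMills.Theorems.MirrorModularBoostsHypercubicLimitDerivToMoments
import Literature.MathematicalPhysics.QuantumLattice.SchwartzReIm
import Literature.MathematicalPhysics.QuantumFieldTheory.LatticeGaugeProofs
import Literature.Analysis.Complex.CauchyTaylorBall

/-!
# Line `Sketch` (coupling response), reshape 3: the plane-resolved transfer chain

Crux `stmt-QuantumFields-16154` (`HypercubicLimit`).  With the plane-resolved objects of `…CouplingResponseDefsC.lean`: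
* `responseDerivBoundsPlanes_of_holomorphy` — anisotropic C⁺ at order one ⇒ `k`-uniform derivative bounds (Cauchy at all
  orders on `|t| = ε₁/2`; the response on the real axis is the tilted expectation);
* `stub_derivToMomentsPlanes` — derivative bounds ⇒ `UniformMomentBoundsPlanes` (the abstract `tiltedMomentBounds` with the
  linear field `f ↦ Φ^P_k(f)` on 6-tuples of tests, admissible set `{normP s ≤ 1}`, relation `DisjP`);
* `sum_planeField_eq_curvField`, `uniformMomentBounds_of_planes` — the six plane fields sum to the curvature field, so
  the plane-resolved bounds contain the curvature bounds `UniformMomentBounds` of reshape 2 (`C₁ ↦ 6C₁`).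
All three registered as sub-goals of the crux item; no `sorry`.
-/

noncomputable section

open MeasureTheory ProbabilityTheory Filter Topology Finset
open Literature.MathematicalPhysics.AQFT Literature.MathematicalPhysics.QuantumLattice
open Literature.MathematicalPhysics.QuantumFieldTheory

namespace Summit.QuantumFields.YangMills.Cruxes.HypercubicLimit.CouplingResponse

/-! ## The plane-resolved stub: `ResponseDerivBoundsPlanes → UniformMomentBoundsPlanes`, and planes ⇒ curvature -/

section Planes

open Literature.MathematicalPhysics.QuantumLattice Literature.MathematicalPhysics.QuantumFieldTheory
open scoped SchwartzMap

variable {G : Type} [Group G] [TopologicalSpace G] [IsTopologicalGroup G] [CompactSpace G]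
  [MeasurableSpace G] [BorelSpace G]

omit [TopologicalSpace G] [IsTopologicalGroup G] [CompactSpace G] [MeasurableSpace G] [BorelSpace G] [Group G] in
/-- **Normalised sign combinations of 6-tuples stay normalised** in the total norm `normP`. [folklore] -/
theorem normP_signCombination_le {s m : ℕ} (v : Fin m → Plane → 𝓢(EuclideanSpace ℝ (Fin 4), ℝ))
    (ε : Fin m → Fin 2) (hv : ∀ i, normP s (v i) ≤ 1) :
    normP s ((m : ℝ)⁻¹ • ∑ i, (-1 : ℝ) ^ (ε i : ℕ) • v i) ≤ 1 := by
  unfold normP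
  have hcomp : ∀ q : Plane, ((m : ℝ)⁻¹ • ∑ i, (-1 : ℝ) ^ (ε i : ℕ) • v i) q =
      (m : ℝ)⁻¹ • ∑ i, (-1 : ℝ) ^ (ε i : ℕ) • v i q := fun q => by
    simp only [Pi.smul_apply, Finset.sum_apply]
  have hq : ∀ q : Plane, schwartzNorm s (ofRealTest (((m : ℝ)⁻¹ • ∑ i, (-1 : ℝ) ^ (ε i : ℕ) • v i) q)) ≤
      |(m : ℝ)⁻¹| * ∑ i, schwartzNorm s (ofRealTest (v i q)) := by
    intro q
    rw [hcomp q, schwartzNorm_ofRealTest_smul, map_sum]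
    refine mul_le_mul_of_nonneg_left ((schwartzNorm_sum_le s _ _).trans (Finset.sum_le_sum fun i _ => ?_))
      (abs_nonneg _)
    rw [schwartzNorm_ofRealTest_smul, abs_pow, abs_neg, abs_one, one_pow, one_mul]
  refine (Finset.sum_le_sum fun q _ => hq q).trans ?_
  rw [← Finset.mul_sum, Finset.sum_comm]
  have hle : ∑ i, ∑ q, schwartzNorm s (ofRealTest (v i q)) ≤ m := by
    calc ∑ i, ∑ q, schwartzNorm s (ofRealTest (v i q)) ≤ ∑ _i : Fin m, (1 : ℝ) :=
          Finset.sum_le_sum fun i _ => hv i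
      _ = m := by simp
  rcases Nat.eq_zero_or_pos m with hm | hm
  · subst hm
    simp
  · have hmpos : (0 : ℝ) < m := by exact_mod_cast hm
    rw [abs_of_pos (inv_pos.2 hmpos)]
    calc (m : ℝ)⁻¹ * ∑ i, ∑ q, schwartzNorm s (ofRealTest (v i q)) ≤ (m : ℝ)⁻¹ * m :=
          mul_le_mul_of_nonneg_left hle (inv_nonneg.2 hmpos.le)
      _ = 1 := inv_mul_cancel₀ hmpos.ne'

omit [TopologicalSpace G] [IsTopologicalGroup G] [CompactSpace G] [MeasurableSpace G] [BorelSpace G] [Group G] in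
/-- **Plane-wise disjointness is stable under linear combinations** of 6-tuples. [folklore] -/
theorem disjP_sum_smul {m : ℕ} (f₀ : Plane → 𝓢(EuclideanSpace ℝ (Fin 4), ℝ))
    (v : Fin m → Plane → 𝓢(EuclideanSpace ℝ (Fin 4), ℝ)) (c : Fin m → ℝ) (hd : ∀ i, DisjP f₀ (v i)) :
    DisjP f₀ (∑ i, c i • v i) := by
  intro q q'
  have h : (∑ i, c i • v i) q' = ∑ i, c i • v i q' := by
    simp only [Finset.sum_apply, Pi.smul_apply]
  rw [h]
  exact disjoint_tsupport_sum_smul (f₀ q) (fun i => v i q') c fun i => hd i q q'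

/-- **Stub `stub_derivToMomentsPlanes` of line `Sketch` (reshape 3) — derivatives ⇒ moments, plane-resolved.**
`k`-uniform bounds `C₀ C₁ⁿ n!` on all real derivatives at `0` of the anisotropic order-one tilted responses for all normalised
plane-wise disjoint pairs of 6-tuples imply `k`-uniform bounds `Dⁿ n!` (`D = 2C₀ + 2e|C₁| + 1`) on the moments of products
of anisotropically smeared fields on normalised, pairwise plane-wise disjoint families — the abstract `tiltedMomentBounds`
with the linear field `f ↦ Φ^P_k(f)` on the module of 6-tuples of real tests. [folklore] -/
theorem stub_derivToMomentsPlanes :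
    ∀ (G : Type) [Group G] [TopologicalSpace G] [IsTopologicalGroup G] [CompactSpace G] [MeasurableSpace G] [BorelSpace G] (r : LatticeRep G) (sch : SpeciesScheme (YMSpecies G)), ResponseDerivBoundsPlanes r sch → UniformMomentBoundsPlanes r sch := by
  intro G _ _ _ _ _ _ r sch hRDB
  obtain ⟨s, C₀, C₁, h⟩ := hRDB
  have h00 : normP s (0 : Plane → 𝓢(EuclideanSpace ℝ (Fin 4), ℝ)) ≤ 1 := by
    unfold normP
    simp only [Pi.zero_apply, map_zero]
    have hz : schwartzNorm s (0 : 𝓢(EuclideanSpace ℝ (Fin 4), ℂ)) = 0 :=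
      map_zero ((Finset.Iic (s, s)).sup (schwartzSeminormFamily ℂ (EuclideanSpace ℝ (Fin 4)) ℂ))
    simp [hz]
  have hd00 : DisjP (0 : Plane → 𝓢(EuclideanSpace ℝ (Fin 4), ℝ)) 0 := by
    intro q q'
    simp only [Pi.zero_apply]
    rw [(tsupport_eq_empty_iff (f := ⇑(0 : 𝓢(EuclideanSpace ℝ (Fin 4), ℝ)))).2 rfl]
    exact disjoint_bot_left
  have hC₀ : 0 ≤ C₀ := by
    have := h 0 0 h00 h00 hd00 0 0
    simp only [pow_zero, mul_one, Nat.factorial_zero, Nat.cast_one] at this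
    exact (abs_nonneg _).trans this
  refine ⟨s, 1, 2 * C₀ + 2 * Real.exp 1 * |C₁| + 1, fun n F hF hdis k => ?_⟩
  rw [one_mul]
  haveI : IsProbabilityMeasure (wilsonAt r sch k) :=
    isProbabilityMeasure_wilsonMeasure (d := 4) (L := sch.side k) r.ρ r.continuous (sch.β k)
  let Φ : (Plane → 𝓢(EuclideanSpace ℝ (Fin 4), ℝ)) →ₗ[ℝ] (GaugeConfig 4 (sch.side k) G → ℝ) :=
    { toFun := fun g => fieldP r sch k g
      map_add' := fun g g' => funext fun U => fieldP_add r sch k g g' U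
      map_smul' := fun c g => funext fun U => fieldP_smul r sch k c g U }
  have hΦ : ∀ g, IsBddMeas (Φ g) := fun g => ⟨measurable_fieldP r sch k g, exists_bound_fieldP r sch k g⟩
  have hmain := abs_integral_prod_le_of_tilted_deriv_bounds (μ := wilsonAt r sch k) Φ hΦ
    {g | normP s g ≤ 1} DisjP
    (fun m v ε hv => normP_signCombination_le v ε hv)
    (fun f₀ m v c hdv => disjP_sum_smul f₀ v c hdv) hC₀ (abs_nonneg C₁)
    (fun f₀ f₁ hf₀ hf₁ hdf m => (h f₀ f₁ hf₀ hf₁ hdf k m).trans (by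
      refine mul_le_mul_of_nonneg_right (mul_le_mul_of_nonneg_left ?_ hC₀) (Nat.cast_nonneg _)
      rw [pow_abs]
      exact le_abs_self _))
    n F hF hdis
  exact hmain

/-- **The six plane fields sum to the curvature field** (the curvature species is the sum of the six plaquette species and
its counterterm is split evenly). [folklore] -/
theorem sum_planeField_eq_curvField (r : LatticeRep G) (sch : SpeciesScheme (YMSpecies G)) (k : ℕ)
    (f : 𝓢(EuclideanSpace ℝ (Fin 4), ℝ)) (U : GaugeConfig 4 (sch.side k) G) :
    ∑ q, planeField r sch k q f U = curvField r sch k f U := by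
  unfold planeField curvField smearedLatticeField
  rw [← Finset.mul_sum]
  congr 1
  rw [Finset.sum_comm]
  refine Finset.sum_congr rfl fun x _ => ?_
  rw [← Finset.mul_sum]
  congr 1
  rw [Finset.sum_sub_distrib]
  have hcard : (Finset.univ : Finset Plane).card = 6 := by decide
  rw [Finset.sum_const, hcard, nsmul_eq_mul]
  have hP : ∑ q : Plane, (planeSpecies r q).F (configShift (-x) (torusLift (sch.side k) U)) =
      r.curvature.F (configShift (-x) (torusLift (sch.side k) U)) := by
    simp only [planeSpecies_F]
    show ∑ q : Plane, plaquetteObs r.ρ 0 q.1.1 q.1.2 (configShift (-x) (torusLift (sch.side k) U)) =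
      actionDensity r.ρ (configShift (-x) (torusLift (sch.side k) U))
    unfold actionDensity
    rw [← Finset.sum_subtype (Finset.univ.filter fun q : Fin 4 × Fin 4 => q.1 < q.2) (by simp)
      (fun q : Fin 4 × Fin 4 => plaquetteObs r.ρ 0 q.1 q.2 (configShift (-x) (torusLift (sch.side k) U))),
      Finset.sum_filter, ← Finset.univ_product_univ, Finset.sum_product]
  rw [hP]
  ring

/-- **Plane-resolved bounds give the curvature bounds** (`UniformMomentBounds`, the input of the old closure chain):
`Φ_k(f) = Φ^P_k(f, …, f) = 6 · Φ^P_k(f/6, …, f/6)` with `normP s (f/6, …, f/6) = |f|_s`, so `C₁` becomes `6 C₁`. [folklore] -/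
theorem uniformMomentBounds_of_planes :
    ∀ (G : Type) [Group G] [TopologicalSpace G] [IsTopologicalGroup G] [CompactSpace G] [MeasurableSpace G] [BorelSpace G] (r : LatticeRep G) (sch : SpeciesScheme (YMSpecies G)), UniformMomentBoundsPlanes r sch → UniformMomentBounds r sch := by
  intro G _ _ _ _ _ _ r sch h
  obtain ⟨s, C₀, C₁, h⟩ := h
  refine ⟨s, C₀, 6 * C₁, fun n f hf hdis k => ?_⟩
  -- the constant tuples `f i / 6`
  set F : Fin n → Plane → 𝓢(EuclideanSpace ℝ (Fin 4), ℝ) := fun i _ => (6 : ℝ)⁻¹ • f i with hF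
  have hnorm : ∀ i, normP s (F i) ≤ 1 := fun i => by
    unfold normP
    simp only [hF, schwartzNorm_ofRealTest_smul, Finset.sum_const]
    have hcard : (Finset.univ : Finset Plane).card = 6 := by decide
    rw [hcard, nsmul_eq_mul, abs_of_pos (by norm_num : (0 : ℝ) < 6⁻¹)]
    have := hf i
    linarith
  have hdisP : ∀ i j, i ≠ j → DisjP (F i) (F j) := fun i j hij q q' =>
    ((hdis i j hij).mono (tsupport_smul_subset_right (fun _ => (6 : ℝ)⁻¹) _)
      (tsupport_smul_subset_right (fun _ => (6 : ℝ)⁻¹) _))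
  have hfield : ∀ i U, curvField r sch k (f i) U = 6 * fieldP r sch k (F i) U := fun i U => by
    rw [← sum_planeField_eq_curvField]
    unfold fieldP
    rw [Finset.mul_sum]
    refine Finset.sum_congr rfl fun q _ => ?_
    have := fieldP_smul r sch k 6 (F i) U
    unfold planeField
    rw [show (f i) = (6 : ℝ) • ((6 : ℝ)⁻¹ • f i) by rw [smul_smul]; norm_num, smearedLatticeField_smul]
  have hprod : ∀ U, ∏ i, curvField r sch k (f i) U = 6 ^ n * ∏ i, fieldP r sch k (F i) U := fun U => by
    simp_rw [hfield]
    rw [Finset.prod_mul_distrib, Finset.prod_const, Finset.card_univ, Fintype.card_fin]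
  have hb := h n F hnorm hdisP k
  show |∫ U, ∏ i, curvField r sch k (f i) U ∂(wilsonAt r sch k)| ≤ C₀ * (6 * C₁) ^ n * n.factorial
  simp_rw [hprod]
  rw [integral_const_mul, abs_mul, abs_pow, abs_of_pos (by norm_num : (0 : ℝ) < 6), mul_pow]
  calc (6 : ℝ) ^ n * |∫ U, ∏ i, fieldP r sch k (F i) U ∂wilsonAt r sch k| ≤ 6 ^ n * (C₀ * C₁ ^ n * n.factorial) :=
        mul_le_mul_of_nonneg_left hb (by positivity)
    _ = C₀ * (6 ^ n * C₁ ^ n) * n.factorial := by ring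

end Planes

/-! ## Glue for reshape 3: anisotropic C⁺ at order one ⇒ plane-resolved derivative bounds (Cauchy at all orders) -/

section CauchyPlanes

open Literature.MathematicalPhysics.QuantumLattice Literature.MathematicalPhysics.QuantumFieldTheory
open scoped SchwartzMap

/-- Real versus complex iterated derivatives along the real axis (holomorphic `Q` on `|t| < ε` with real restriction
`g`): `g⁽ⁿ⁾(x) = re Q⁽ⁿ⁾(↑x)` on `(-ε, ε)`.
-- adapted from Theorems/MirrorModularBoostsHypercubicLimitCauchyTransferAll.lean (private there) [folklore] -/
theorem planes_iteratedDeriv_eq_re {Q : ℂ → ℂ} {g : ℝ → ℝ} {ε : ℝ}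
    (hQ : DifferentiableOn ℂ Q (Metric.ball 0 ε)) (hg : ∀ t : ℝ, Q (t : ℂ) = ((g t : ℝ) : ℂ))
    (n : ℕ) : ∀ x ∈ Set.Ioo (-ε) ε, iteratedDeriv n g x = (iteratedDeriv n Q (x : ℂ)).re := by
  have hA : AnalyticOnNhd ℂ Q (Metric.ball 0 ε) := hQ.analyticOnNhd Metric.isOpen_ball
  have hmem : ∀ x ∈ Set.Ioo (-ε) ε, ((x : ℝ) : ℂ) ∈ Metric.ball (0 : ℂ) ε := by
    intro x hx
    rw [Metric.mem_ball, dist_zero_right, Complex.norm_real, Real.norm_eq_abs, abs_lt]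
    exact hx
  induction n with
  | zero =>
    intro x _
    rw [iteratedDeriv_zero, iteratedDeriv_zero, hg, Complex.ofReal_re]
  | succ n ih =>
    intro x hx
    have hAn : AnalyticOnNhd ℂ (iteratedDeriv n Q) (Metric.ball 0 ε) := by
      rw [iteratedDeriv_eq_iterate]
      exact hA.iterated_deriv n
    have hd : HasDerivAt (iteratedDeriv n Q) (iteratedDeriv (n + 1) Q (x : ℂ)) (x : ℂ) := by
      rw [iteratedDeriv_succ]
      exact (hAn _ (hmem x hx)).differentiableAt.hasDerivAt
    have hre : HasDerivAt (fun t : ℝ => (iteratedDeriv n Q (t : ℂ)).re)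
        (iteratedDeriv (n + 1) Q (x : ℂ)).re x := hd.real_of_complex
    have hev : iteratedDeriv n g =ᶠ[𝓝 x] fun t : ℝ => (iteratedDeriv n Q (t : ℂ)).re :=
      Filter.eventuallyEq_of_mem (Ioo_mem_nhds hx.1 hx.2) fun t ht => ih t ht
    rw [iteratedDeriv_succ, hev.deriv_eq, hre.deriv]

/-- Cauchy transfer at all orders (abstract): `|g⁽ⁿ⁾(0)| ≤ n! B / (ε/2)ⁿ` for the real restriction `g` of a function `Q`
holomorphic and bounded by `B` on `|t| < ε`.
-- adapted from Theorems/MirrorModularBoostsHypercubicLimitCauchyTransferAll.lean (private there) [folklore] -/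
theorem planes_abs_iteratedDeriv_le {Q : ℂ → ℂ} {g : ℝ → ℝ} {ε B : ℝ} (hε : 0 < ε)
    (hQ : DifferentiableOn ℂ Q (Metric.ball 0 ε)) (hB : ∀ t ∈ Metric.ball (0 : ℂ) ε, ‖Q t‖ ≤ B)
    (hg : ∀ t : ℝ, Q (t : ℂ) = ((g t : ℝ) : ℂ)) (n : ℕ) :
    |iteratedDeriv n g 0| ≤ n.factorial * B / (ε / 2) ^ n := by
  have h := Literature.Analysis.Complex.norm_iteratedDeriv_le_of_forall_mem_ball hε hQ hB n
  have h0 : (0 : ℝ) ∈ Set.Ioo (-ε) ε := ⟨by linarith, hε⟩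
  rw [planes_iteratedDeriv_eq_re hQ hg n 0 h0, Complex.ofReal_zero]
  exact (Complex.abs_re_le_norm _).trans h

/-- **Registered sub-goal `responseDerivBoundsPlanes_of_holomorphy` (line `Sketch`, reshape 3) — the glue**: anisotropic C⁺ at
order one with radius `ε₁ > 0` and bound `C₀` gives the plane-resolved `k`-uniform derivative bounds with `C₁ = 2/ε₁`
(the response on the real axis IS the tilted expectation, `response_ofReal`; Cauchy's inequality on `|t| = ε₁/2`). [folklore] -/
theorem responseDerivBoundsPlanes_of_holomorphy :
    ∀ (G : Type) [Group G] [TopologicalSpace G] [IsTopologicalGroup G] [CompactSpace G] [MeasurableSpace G] [BorelSpace G] (r : LatticeRep G) (sch : SpeciesScheme (YMSpecies G)) (s : ℕ) (ε₁ C₀ : ℝ), 0 < ε₁ → ResponseHolomorphyOnePlanes r sch s ε₁ C₀ → ResponseDerivBoundsPlanes r sch := by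
  intro G _ _ _ _ _ _ r sch s ε₁ C₀ hε₁ h
  refine ⟨s, C₀, 2 / ε₁, fun f g hf hg hd k n => ?_⟩
  obtain ⟨hD, hB⟩ := h f g hf hg hd k
  have hc := planes_abs_iteratedDeriv_le hε₁ hD hB
    (fun t => response_ofReal (μ := wilsonAt r sch k) (fieldP r sch k f) (fieldP r sch k g) t) n
  refine hc.trans (le_of_eq ?_)
  rw [div_pow, div_pow]
  field_simp

end CauchyPlanes

end Summit.QuantumFields.YangMills.Cruxes.HypercubicLimit.CouplingResponse

end
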